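import Literature.AlgebraicGeometry.GroupSchemes.CartierDualQuotient
import Mathlib.AlgebraicGeometry.Morphisms.IsIso
import Mathlib.LinearAlgebra.Dual.Lemmas
import HarnessLib

/-!
# Cartier duality is exact: the dual of a closed subgroup is a faithfully flat quotient map with kernel `H^⊥`, `G^D⧸H^⊥ ≅ H^D`,
# and the dual of a faithfully flat homomorphism is a closed immersion (Tate 1997 §(3.8); Waterhouse 1979 §14)

Layer `Literature/AlgebraicGeometry/GroupSchemes`, namespace `Literature.AlgebraicGeometry.GroupSchemes.AffineGroupScheme` (continues ★ `CartierDualMap`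
p845343, ★ `CartierDualAnnihilator(Rank)` p845459 ∕ p845797, ★ `CartierDualQuotient` p846266 — `quot`, `quotProj`, `quotDesc`, `injective_comap_quotProj` —, ★
`FiniteGroupSchemeKernelRank` — `Γ(f)` injective ⟹ `f` flat and surjective —).  THEOREMS ONLY (no definition, no instance, no notation, no named fact, no
`sorry`).  Cell `hodgecm-mathlib` (D-0151), programme P6 «MOD», organ (EX) of B-p04 (g38): the exactness half of the Cartier-duality dictionary.  Count-neutral
Mathlib-side capital: HC_CM is proved only modulo the printed citations until rung 0 closes; nothing here bears on it.

THE PRINT ([Tate1997FiniteFlatGroupSchemes] §(3.8) p. 146: «the functor `G ↦ G^D` is exact»: for `0 → H → G → G⧸H → 0` the dual sequence `0 → (G⧸H)^D →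
G^D → H^D → 0` is exact; [Waterhouse1979] §14.1: a homomorphism of affine group schemes over a field with `Γ` injective is faithfully flat (a quotient
map), one with `Γ` surjective is a closed immersion, and every homomorphism of finite group schemes factors as quotient map followed by closed
immersion).  For finite (free) commutative affine group objects over `R` ∕ over a field `k` and a homomorphism `f : G₁ → G₂`:

* §1 (any `R`) `injective_comap_cartierDualMap_iff : Γ(f^D)` injective ⟺ `(Γ(f))^* = DualAlg.transpose f` injective; `surjective_…_iff` likewise (the
  conjugation ★ `algCartierDualEquiv_comp_comap_cartierDualMap`); `injective_comap_cartierDualMap_of_isClosedImmersion`.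
* §2 (field) THE DUAL OF A CLOSED IMMERSION IS A QUOTIENT MAP: **`flat_cartierDualMap_left_of_isClosedImmersion`**, **`surjective_cartierDualMap_left_of_isClosedImmersion`**
  — `j^D : G^D → H^D` is faithfully flat, with kernel `H^⊥ = ker (j^D)` BY DEFINITION (★ `annihilator_def`).
* §3 (field) THE DUAL OF A QUOTIENT MAP IS A CLOSED IMMERSION: `surjective_transpose_of_injective_comap` (Mathlib `LinearMap.dualMap_surjective_of_injective`),
  **`isClosedImmersion_cartierDualMap_left_of_injective_comap`**, **`isClosedImmersion_cartierDualMap_left_of_flat_of_surjective`**.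
* §4 (field) **`G^D⧸H^⊥ ≅ H^D`**: `injective_comap_quotDesc_cartierDualMap`, `finrank_alg_quot_annihilatorι` (`rk Γ(G^D⧸H^⊥) = rk Γ(H)`), HEAD
  **`isIso_quotDesc_cartierDualMap : IsIso (quotDesc (annihilatorι j) (cartierDualMap j) (annihilatorι_comp j))`** — the canonical map `G^D⧸H^⊥ → H^D` (★ universal
  property of `quot`) is an ISOMORPHISM (`Γ` injective of equal rank ⇒ bijective; an affine morphism with bijective `Γ` is an isomorphism).

## References
* [Tate1997FiniteFlatGroupSchemes] J. Tate, *Finite flat group schemes*, in: Modular Forms and Fermat's Last Theorem (1997), §(3.8) pp. 145–146.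
* [Waterhouse1979] W. C. Waterhouse, *Introduction to Affine Group Schemes*, GTM 66 (1979), §14.1 Theorem, §15.1.
-/

set_option autoImplicit false

-- Mathlib's `Over`/`Scheme` APIs are stated across semireducible wrappers (as in the ★ `GroupSchemes/*` files).
set_option backward.isDefEq.respectTransparency false

universe u

open CategoryTheory CategoryTheory.Limits AlgebraicGeometry MonoidalCategory CartesianMonoidalCategory TensorProduct WithConv

noncomputable section

namespace Literature.AlgebraicGeometry.GroupSchemes

namespace AffineGroupScheme

open scoped MonObj

open Literature.AlgebraicGeometry.Motives Literature.NumberTheory.DiophantineGeometry Literature.RingTheory.HopfAlgebra GroupSchemeKernel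

/-! ## §1 `Γ(f^D)` is injective ∕ surjective iff the transpose of `Γ(f)` is -/

section AnyBase

variable {R : Type u} [CommRing R] {G₁ G₂ : SchemeOver R}
  [GrpObj G₁] [IsCommMonObj G₁] [IsAffine G₁.left] [GrpObj G₂] [IsCommMonObj G₂] [IsAffine G₂.left] (f : G₁ ⟶ G₂) [IsMonHom f]

/-- `e_{G₂} (Γ(f^D) a) = (Γ(f))^* (e_{G₁} a)` — ★ `algCartierDualEquiv_comp_comap_cartierDualMap` applied to an element. [cite: Tate1997FiniteFlatGroupSchemes, §(3.8) p. 145] -/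
theorem algCartierDualEquiv_comap_cartierDualMap_apply (a : Alg (cartierDual G₁)) :
    algCartierDualEquiv G₂ (Alg.comap (cartierDualMap f) a) = DualAlg.transpose f (algCartierDualEquiv G₁ a) :=
  AlgHom.congr_fun (algCartierDualEquiv_comp_comap_cartierDualMap f) a

/-- **`Γ(f^D)` is injective iff `(Γ(f))^*` is** (they are conjugate by the algebra isomorphisms `e : Γ(·^D) ≃ Γ(·)^*`).
[cite: Tate1997FiniteFlatGroupSchemes, §(3.8) p. 145] -/
theorem injective_comap_cartierDualMap_iff : Function.Injective (Alg.comap (cartierDualMap f)) ↔ Function.Injective (DualAlg.transpose f) := by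
  constructor
  · intro h x y hxy
    obtain ⟨a, rfl⟩ := (algCartierDualEquiv G₁).surjective x
    obtain ⟨b, rfl⟩ := (algCartierDualEquiv G₁).surjective y
    rw [← algCartierDualEquiv_comap_cartierDualMap_apply, ← algCartierDualEquiv_comap_cartierDualMap_apply] at hxy
    rw [h ((algCartierDualEquiv G₂).injective hxy)]
  · intro h a b hab
    have h' : DualAlg.transpose f (algCartierDualEquiv G₁ a) = DualAlg.transpose f (algCartierDualEquiv G₁ b) := by
      rw [← algCartierDualEquiv_comap_cartierDualMap_apply, ← algCartierDualEquiv_comap_cartierDualMap_apply, hab]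
    exact (algCartierDualEquiv G₁).injective (h h')

/-- **`Γ(f^D)` is surjective iff `(Γ(f))^*` is.** [cite: Tate1997FiniteFlatGroupSchemes, §(3.8) p. 145] -/
theorem surjective_comap_cartierDualMap_iff : Function.Surjective (Alg.comap (cartierDualMap f)) ↔ Function.Surjective (DualAlg.transpose f) := by
  constructor
  · intro h y
    obtain ⟨c, hc⟩ := h ((algCartierDualEquiv G₂).symm y)
    refine ⟨algCartierDualEquiv G₁ c, ?_⟩
    rw [← algCartierDualEquiv_comap_cartierDualMap_apply, hc, AlgEquiv.apply_symm_apply]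
  · intro h c
    obtain ⟨x, hx⟩ := h (algCartierDualEquiv G₂ c)
    refine ⟨(algCartierDualEquiv G₁).symm x, (algCartierDualEquiv G₂).injective ?_⟩
    rw [algCartierDualEquiv_comap_cartierDualMap_apply, AlgEquiv.apply_symm_apply, hx]

/-- **For a closed immersion `j : H ↪ G`, `Γ(j^D) : Γ(H^D) → Γ(G^D)` is injective** (`Γ(j)` is surjective, its transpose injective: ★
`injective_transpose_of_isClosedImmersion`). [cite: Tate1997FiniteFlatGroupSchemes, §(3.8) p. 146] -/
theorem injective_comap_cartierDualMap_of_isClosedImmersion [IsClosedImmersion f.left] : Function.Injective (Alg.comap (cartierDualMap f)) :=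
  (injective_comap_cartierDualMap_iff f).2 (injective_transpose_of_isClosedImmersion f)

end AnyBase

/-! ## §2 Over a field: the dual of a closed immersion is faithfully flat -/

section Field

variable {k : Type u} [Field k] {H G : SchemeOver k}
  [GrpObj H] [IsCommMonObj H] [IsAffine H.left] [Module.Finite k (Alg H)]
  [GrpObj G] [IsCommMonObj G] [IsAffine G.left] [Module.Finite k (Alg G)]
  (j : H ⟶ G) [IsMonHom j]

/-- **`j^D : G^D → H^D` is FLAT for a closed immersion `j`** (★ `flat_left_of_comap_injective`: over a field a homomorphism of finite group schemes with `Γ`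
injective is faithfully flat, [Waterhouse1979] §14.1). [cite: Tate1997FiniteFlatGroupSchemes, §(3.8) p. 146] [cite: Waterhouse1979, §14.1 Theorem] -/
theorem flat_cartierDualMap_left_of_isClosedImmersion [IsClosedImmersion j.left] : Flat (cartierDualMap j).left :=
  flat_left_of_comap_injective (cartierDualMap j) (injective_comap_cartierDualMap_of_isClosedImmersion j)

/-- **`j^D : G^D → H^D` is SURJECTIVE for a closed immersion `j`** — with `flat_…` and ★ `annihilator_def : H^⊥ = ker (j^D)`, this is the exactness of
`0 → H^⊥ → G^D → H^D → 0` ([Tate1997FiniteFlatGroupSchemes] §(3.8): «`G ↦ G^D` is exact»). [cite: Tate1997FiniteFlatGroupSchemes, §(3.8) p. 146]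
[cite: Waterhouse1979, §14.1 Theorem] -/
theorem surjective_cartierDualMap_left_of_isClosedImmersion [IsClosedImmersion j.left] : Surjective (cartierDualMap j).left :=
  surjective_left_of_comap_injective (cartierDualMap j) (injective_comap_cartierDualMap_of_isClosedImmersion j)

/-! ## §3 Over a field: the dual of a quotient map is a closed immersion -/

omit [Module.Finite k (Alg H)] [Module.Finite k (Alg G)] in
/-- **If `Γ(f) : Γ(G₂) → Γ(G₁)` is injective then its transpose `Γ(G₁)^* → Γ(G₂)^*` is surjective** (restriction of linear forms along an injective linear
map of vector spaces, Mathlib `LinearMap.dualMap_surjective_of_injective`). [cite: Waterhouse1979, §14.1 Theorem] -/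
theorem surjective_transpose_of_injective_comap (hj : Function.Injective (Alg.comap j)) : Function.Surjective (DualAlg.transpose j) := by
  intro y
  obtain ⟨x, hx⟩ := LinearMap.dualMap_surjective_of_injective (f := (Alg.comap j).toLinearMap) hj
    (WithConv.ofConv (show WithConv (Module.Dual k (Alg G)) from y))
  refine ⟨(show DualAlg H from WithConv.toConv x), ?_⟩
  apply WithConv.ofConv_injective
  rw [DualAlg.ofConv_transpose]
  exact hx

omit [Module.Finite k (Alg H)] [Module.Finite k (Alg G)] in
/-- **`f^D` IS A CLOSED IMMERSION WHEN `Γ(f)` IS INJECTIVE**: `(f^D).left = Spec (Γ(f))^*` (★ `cartierDualMap_left`) with `(Γ(f))^*` surjective (Mathlib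
`IsClosedImmersion.spec_of_surjective`). [cite: Waterhouse1979, §14.1 Theorem] [cite: Tate1997FiniteFlatGroupSchemes, §(3.8) p. 146] -/
theorem isClosedImmersion_cartierDualMap_left_of_injective_comap (hj : Function.Injective (Alg.comap j)) : IsClosedImmersion (cartierDualMap j).left := by
  rw [cartierDualMap_left]
  exact IsClosedImmersion.spec_of_surjective _ (surjective_transpose_of_injective_comap j hj)

omit [Module.Finite k (Alg H)] [Module.Finite k (Alg G)] in
/-- **THE DUAL OF A FAITHFULLY FLAT HOMOMORPHISM IS A CLOSED IMMERSION**: `f` flat and surjective ⟹ `Γ(f)` injective (★ `comap_injective_of_flat_of_surjective`)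
⟹ `f^D` a closed immersion. [cite: Waterhouse1979, §14.1 Theorem] [cite: Tate1997FiniteFlatGroupSchemes, §(3.8) p. 146] -/
theorem isClosedImmersion_cartierDualMap_left_of_flat_of_surjective [Flat j.left] [Surjective j.left] : IsClosedImmersion (cartierDualMap j).left :=
  isClosedImmersion_cartierDualMap_left_of_injective_comap j (comap_injective_of_flat_of_surjective j)

/-! ## §4 Over a field: `G^D⧸H^⊥ ≅ H^D` -/

variable [IsClosedImmersion j.left]

/-- **`Γ` of the canonical map `G^D⧸H^⊥ → H^D` is injective**: `quotProj ≫ quotDesc = j^D` (★ `quotProj_comp_quotDesc`), so `Γ(j^D) = Γ(quotProj) ∘ Γ(quotDesc)` is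
injective (§1) and so is its first factor `Γ(quotDesc)`. [cite: Tate1997FiniteFlatGroupSchemes, §(3.8) p. 146] -/
theorem injective_comap_quotDesc_cartierDualMap :
    Function.Injective (Alg.comap (quotDesc (annihilatorι j) (cartierDualMap j) (annihilatorι_comp j))) := by
  have h := injective_comap_cartierDualMap_of_isClosedImmersion j
  rw [← quotProj_comp_quotDesc (annihilatorι j) (cartierDualMap j) (annihilatorι_comp j), Alg.comap_comp, AlgHom.coe_comp] at h
  exact h.of_comp

/-- **`rk Γ(G^D⧸H^⊥) = rk Γ(H)`** (`rk (G^D⧸H^⊥) · rk H^⊥ = rk G^D = rk G = rk H^⊥ · rk H`: ★ `finrank_alg_quot_mul_finrank`, ★ `finrank_alg_cartierDual`, ★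
`finrank_alg_annihilator_mul_finrank`). [cite: Tate1997FiniteFlatGroupSchemes, §(3.8) p. 145] -/
theorem finrank_alg_quot_annihilatorι : Module.finrank k (Alg (quot (annihilatorι j))) = Module.finrank k (Alg H) := by
  haveI := isClosedImmersion_annihilatorι_left j
  have h1 := finrank_alg_quot_mul_finrank (annihilatorι j)
  have h2 := finrank_alg_annihilator_mul_finrank j
  rw [finrank_alg_cartierDual G] at h1
  have hpos : 0 < Module.finrank k (Alg (annihilator j)) := finrank_alg_pos (H := annihilator j)
  refine Nat.eq_of_mul_eq_mul_right hpos ?_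
  calc Module.finrank k (Alg (quot (annihilatorι j))) * Module.finrank k (Alg (annihilator j))
        = Module.finrank k (Alg G) := h1
    _ = Module.finrank k (Alg (annihilator j)) * Module.finrank k (Alg H) := h2.symm
    _ = Module.finrank k (Alg H) * Module.finrank k (Alg (annihilator j)) := mul_comm _ _

omit [GrpObj H] [IsCommMonObj H] [Module.Finite k (Alg H)] [GrpObj G] [IsCommMonObj G] [Module.Finite k (Alg G)] [IsMonHom j] [IsClosedImmersion j.left] in
/-- An `R`-morphism of affine schemes whose map on global sections is bijective is an isomorphism (Mathlib: isomorphisms have the affine property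
«affine source and `Γ` an isomorphism»; `Over.forget` reflects isomorphisms). [cite: Waterhouse1979, §14.1 Theorem] -/
theorem isIso_of_bijective_comap {X Y : SchemeOver k} [IsAffine X.left] [IsAffine Y.left] (φ : X ⟶ Y) (hφ : Function.Bijective (Alg.comap φ)) :
    IsIso φ := by
  haveI : IsIso φ.left.appTop := (ConcreteCategory.isIso_iff_bijective φ.left.appTop).mpr hφ
  have hP : (MorphismProperty.isomorphisms Scheme) φ.left :=
    (HasAffineProperty.iff_of_isAffine (P := MorphismProperty.isomorphisms Scheme)).mpr ⟨inferInstance, inferInstance⟩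
  haveI : IsIso φ.left := (MorphismProperty.isomorphisms.iff _).mp hP
  haveI : IsIso ((Over.forget _).map φ) := by simpa using (inferInstance : IsIso φ.left)
  exact isIso_of_reflects_iso φ (Over.forget _)

/-- **HEAD — CARTIER DUALITY IS EXACT: `G^D⧸H^⊥ ≅ H^D`.**  For a closed subgroup `j : H ↪ G` of a finite commutative group scheme over a field, the canonical
homomorphism `quotDesc : G^D⧸H^⊥ → H^D` through which `j^D` factors (★ `quotProj_comp_quotDesc`, ★ universal property of `quot`) is an ISOMORPHISM: `Γ(quotDesc)`
is injective (§4) between algebras of the same finite dimension (`finrank_alg_quot_annihilatorι`, ★ `DualAlg.finrank_eq`), hence bijective.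
[cite: Tate1997FiniteFlatGroupSchemes, §(3.8) p. 146] [cite: Waterhouse1979, §14.1 Theorem] -/
theorem isIso_quotDesc_cartierDualMap : IsIso (quotDesc (annihilatorι j) (cartierDualMap j) (annihilatorι_comp j)) := by
  apply isIso_of_bijective_comap
  have hinj := injective_comap_quotDesc_cartierDualMap j
  have hdim : Module.finrank k (Alg (cartierDual H)) = Module.finrank k (Alg (quot (annihilatorι j))) := by
    rw [finrank_alg_cartierDual H, finrank_alg_quot_annihilatorι j]
  exact ⟨hinj, ((Alg.comap (quotDesc (annihilatorι j) (cartierDualMap j) (annihilatorι_comp j))).toLinearMap.injective_iff_surjective_of_finrank_eq_finrank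
    hdim).mp hinj⟩

omit [IsClosedImmersion j.left] in
/-- Hence **`j^D = quotProj ≫ (G^D⧸H^⊥ ≅ H^D)`**: the dual of a closed subgroup is, up to a canonical isomorphism, the quotient map of `G^D` by the annihilator
`H^⊥`. [cite: Tate1997FiniteFlatGroupSchemes, §(3.8) p. 146] -/
theorem cartierDualMap_eq_quotProj_comp : cartierDualMap j = quotProj (annihilatorι j) ≫ quotDesc (annihilatorι j) (cartierDualMap j) (annihilatorι_comp j) :=
  (quotProj_comp_quotDesc (annihilatorι j) (cartierDualMap j) (annihilatorι_comp j)).symm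

end Field

end AffineGroupScheme

end Literature.AlgebraicGeometry.GroupSchemes

end
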